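import Literature.NumberTheory.DiophantineGeometry.AbelianSchemeModelSpecialFibre
import Literature.AlgebraicGeometry.Motives.GoodReductionCechProofs
import Mathlib.AlgebraicGeometry.Geometrically.Irreducible
import Mathlib.AlgebraicGeometry.Geometrically.Connected
import HarnessLib

/-!
# The structure morphism of an abelian-scheme model over `𝓞_{K,v}` is geometrically irreducible and geometrically connected
# (Serre–Tate 1968, §1; Mumford–Fogarty–Kirwan, Def. 6.1: «geometric fibres connected»)

Topic `Literature/NumberTheory/DiophantineGeometry`, namespace `Literature.NumberTheory.DiophantineGeometry.IsAbelianSchemeModel`.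
THEOREMS ONLY (no definition, no named fact, no instance, no `sorry`).  Cell `hodgecm-mathlib` (D-0151), FLOOR 0, programme F0P5a
(D9op road 2′, crux item stmt-HodgeConjecture-24832): generic trunk junction **G4** of the L3a pole census
`F0/P5a/L3a-POLE-census.v0.1.F0P5a-p02g0.md` §5.

An abelian-scheme model `𝒜 → Spec 𝓞_{K,v}` of an abelian variety `A/K` at a finite place `v` (the tree's `IsAbelianSchemeModel A v 𝒜`,
`Literature/NumberTheory/DiophantineGeometry/AbelianVarietyOrdinaryReduction.lean`: smooth of relative dimension `dim A`, proper, generic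
fibre `≅ A` as a group scheme) is recorded WITHOUT the clause «geometric fibres connected» of the definition of an abelian scheme
([MumfordFogartyKirwan1994] Ch. 6 §1 Def. 6.1: «an abelian scheme is a group scheme `π : A → S` smooth and proper with geometric fibres
connected»; the tree's bundled `AbelianSchemes.AbelianScheme R` carries it as the field `geometricallyConnected`).  This file PROVES that
clause — indeed geometric irreducibility of EVERY fibre `𝒜 ×_{𝓞_{K,v}} Spec L`, `L` a field — from the two fibres that the tree already
controls: the generic fibre is `A` (geometrically integral) and the special fibre `𝒜_v` is an abelian variety (★
`IsAbelianSchemeModel.specialFibre`, geometrically integral by Zariski's connectedness theorem, [SerreTate1968GoodReduction] §1), while every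
`𝓞_{K,v}`-algebra that is a field receives its structure map either through `K` (kernel `⊥`) or through the residue field `κ(v)` (kernel
`𝔪_v`; `𝓞_{K,v}` is a discrete valuation ring), and geometric irreducibility is stable under the further base change `Spec L → Spec K`,
resp. `Spec L → Spec κ(v)`.

* `geometricallyIrreducible_genericFibre_hom` — `𝒜_K → Spec K` is geometrically irreducible (`𝒜_K ≅ A`);
* `geometricallyIrreducible_specialFibre_hom` — `𝒜_v → Spec κ(v)` is geometrically irreducible (★ `specialFibre`);
* **`geometricallyIrreducible_hom`** — `𝒜 → Spec 𝓞_{K,v}` is geometrically irreducible;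
* **`geometricallyConnected_hom`** — hence geometrically connected: the `geometricallyConnected` field needed to view `𝒜` as a bundled
  `AbelianSchemes.AbelianScheme (valuationSubringAtPrime K v)` inside a proof (e.g. to run ★
  `AbelianScheme.generates_fibre_of_generates_fibre_of_injective` on the Néron model of `Alb(M⋆_K)`, F0P5a trunk T4).

HC_CM is proved only modulo the 7 printed citations until rung 0 closes; this file is a generic leaf and changes no count.

## References
* [SerreTate1968GoodReduction] J.-P. Serre, J. Tate, *Good reduction of abelian varieties*, Ann. of Math. 88 (1968), §1.
* [MumfordFogartyKirwan1994] D. Mumford, J. Fogarty, F. Kirwan, *Geometric Invariant Theory*, 3rd ed. (1994), Ch. 6 §1 Def. 6.1 (p. 115).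
* [StacksProject] Tag 0E0N (Zariski's connectedness theorem), Tag 038H (geometric irreducibility and base change).
-/

set_option autoImplicit false

noncomputable section

open CategoryTheory CategoryTheory.Limits AlgebraicGeometry IsDedekindDomain IsDedekindDomain.HeightOneSpectrum
open scoped MonObj NumberField CategoryTheory.Obj
open Literature.AlgebraicGeometry.Motives (AbelianVariety SchemeOver residueAt residueAt_surjective ker_residueAt
  isDiscreteValuationRing_valuationSubringAtPrime)
open Literature.NumberTheory.EllipticCurves (genericFibre specGenericPoint)

namespace Literature.NumberTheory.DiophantineGeometry

namespace IsAbelianSchemeModel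

variable {K : Type} [Field K] [NumberField K] {v : HeightOneSpectrum (𝓞 K)} {A : AbelianVariety K}
  {𝒜 : SchemeOver (valuationSubringAtPrime K v)} [GrpObj 𝒜]

/-- **The generic fibre `𝒜_K → Spec K` of an abelian-scheme model is geometrically irreducible**: it is isomorphic over `K` to the
abelian variety `A`, whose structure morphism is geometrically integral. [cite: SerreTate1968GoodReduction, §1] -/
theorem geometricallyIrreducible_genericFibre_hom (h : IsAbelianSchemeModel A v 𝒜) :
    GeometricallyIrreducible ((genericFibre (valuationSubringAtPrime K v) K).obj 𝒜).hom := by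
  obtain ⟨e, -⟩ := h.exists_iso
  have hw : ((genericFibre (valuationSubringAtPrime K v) K).obj 𝒜).hom = e.hom.left ≫ A.X.hom := (Over.w e.hom).symm
  rw [hw]
  haveI : IsIso e.hom.left := (inferInstance : IsIso ((Over.forget _).map e.hom))
  haveI : GeometricallyIntegral A.X.hom := A.geometricallyIntegral
  exact MorphismProperty.RespectsIso.precomp @GeometricallyIrreducible e.hom.left A.X.hom inferInstance

/-- **The special fibre `𝒜_v → Spec κ(v)` of an abelian-scheme model is geometrically irreducible** (it is the abelian variety
★ `IsAbelianSchemeModel.specialFibre h`; Zariski's connectedness theorem). [cite: SerreTate1968GoodReduction, §1]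
[cite: StacksProject, Tag 0E0N] -/
theorem geometricallyIrreducible_specialFibre_hom (h : IsAbelianSchemeModel A v 𝒜) :
    GeometricallyIrreducible ((specialFibreFunctor v).obj 𝒜).hom := by
  haveI : GeometricallyIntegral h.specialFibre.X.hom := h.specialFibre.geometricallyIntegral
  exact (inferInstance : GeometricallyIrreducible h.specialFibre.X.hom)

/-- An `𝓞_{K,v}`-algebra structure on a field `L` with injective structure map factors through the fraction field `K`.
[folklore] -/
private theorem exists_comp_eq_of_injective (L : Type) [Field L] [Algebra (valuationSubringAtPrime K v) L]
    (hφ : Function.Injective (algebraMap (valuationSubringAtPrime K v) L)) :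
    ∃ ψ : K →+* L, ψ.comp (algebraMap (valuationSubringAtPrime K v) K) = algebraMap (valuationSubringAtPrime K v) L :=
  ⟨IsFractionRing.lift hφ, RingHom.ext fun x => IsFractionRing.lift_algebraMap hφ x⟩

/-- An `𝓞_{K,v}`-algebra structure on a field `L` with NON-injective structure map factors through the residue field `κ(v)`:
the kernel is a non-zero prime of the discrete valuation ring `𝓞_{K,v}`, hence its maximal ideal `= ker (residueAt v)`.
[folklore] -/
private theorem exists_comp_eq_of_not_injective (L : Type) [Field L] [Algebra (valuationSubringAtPrime K v) L]
    (hφ : ¬ Function.Injective (algebraMap (valuationSubringAtPrime K v) L)) :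
    ∃ ψ : v.asIdeal.ResidueField →+* L, ψ.comp (residueAt v) = algebraMap (valuationSubringAtPrime K v) L := by
  haveI := isDiscreteValuationRing_valuationSubringAtPrime v
  set φ := algebraMap (valuationSubringAtPrime K v) L
  have hker : RingHom.ker φ ≠ ⊥ := by
    intro hbot
    exact hφ ((RingHom.injective_iff_ker_eq_bot φ).2 hbot)
  have hmax : RingHom.ker φ = IsLocalRing.maximalIdeal (valuationSubringAtPrime K v) :=
    IsLocalRing.eq_maximalIdeal ((RingHom.ker_isPrime φ).isMaximal hker)
  have hle : RingHom.ker (residueAt v) ≤ RingHom.ker φ := by rw [ker_residueAt, hmax]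
  exact ⟨(residueAt v).liftOfSurjective (residueAt_surjective v) ⟨φ, hle⟩,
    RingHom.liftOfSurjective_comp _ (residueAt_surjective v) ⟨φ, hle⟩⟩

/-- Pasting: a pull-back of `f` along `Spec L → Spec R₀` that factors as `Spec L → Spec k → Spec R₀` is a pull-back of the base change
`pullback.snd f (Spec k → Spec R₀)` along `Spec L → Spec k`; so a geometric property of that base change gives the property of the
pull-back. Stated for `P = IrreducibleSpace`. [folklore] -/
private theorem irreducibleSpace_of_isPullback_of_factor {R₀ k L : Type} [CommRing R₀] [CommRing k] [Field L]
    {X : Scheme.{0}} (f : X ⟶ Spec (.of R₀)) (q : R₀ →+* k) (ψ : k →+* L) (φ : R₀ →+* L) (hφ : ψ.comp q = φ)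
    (hq : GeometricallyIrreducible (pullback.snd f (Spec.map (CommRingCat.ofHom q))))
    {Y : Scheme.{0}} (fst : Y ⟶ X) (snd : Y ⟶ Spec (.of L))
    (hpb : IsPullback fst snd f (Spec.map (CommRingCat.ofHom φ))) : IrreducibleSpace Y := by
  have hS : Spec.map (CommRingCat.ofHom φ) = Spec.map (CommRingCat.ofHom ψ) ≫ Spec.map (CommRingCat.ofHom q) := by
    rw [← Spec.map_comp, ← CommRingCat.ofHom_comp, hφ]
  have hw : fst ≫ f = (snd ≫ Spec.map (CommRingCat.ofHom ψ)) ≫ Spec.map (CommRingCat.ofHom q) := by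
    rw [Category.assoc, ← hS]; exact hpb.w
  let fst' : Y ⟶ pullback f (Spec.map (CommRingCat.ofHom q)) := pullback.lift fst (snd ≫ Spec.map (CommRingCat.ofHom ψ)) hw
  have h₁ : fst' ≫ pullback.fst f (Spec.map (CommRingCat.ofHom q)) = fst := pullback.lift_fst _ _ _
  have h₂ : fst' ≫ pullback.snd f (Spec.map (CommRingCat.ofHom q)) = snd ≫ Spec.map (CommRingCat.ofHom ψ) :=
    pullback.lift_snd _ _ _
  have hbig : IsPullback (fst' ≫ pullback.fst f (Spec.map (CommRingCat.ofHom q))) snd f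
      (Spec.map (CommRingCat.ofHom ψ) ≫ Spec.map (CommRingCat.ofHom q)) := by
    rw [h₁, ← hS]; exact hpb
  have hpb' : IsPullback fst' snd (pullback.snd f (Spec.map (CommRingCat.ofHom q))) (Spec.map (CommRingCat.ofHom ψ)) :=
    IsPullback.of_right hbig h₂ (IsPullback.of_hasPullback f (Spec.map (CommRingCat.ofHom q)))
  exact hq.geometrically_irreducibleSpace _ _ _ hpb'

/-- **The structure morphism `𝒜 → Spec 𝓞_{K,v}` of an abelian-scheme model is geometrically irreducible**: every fibre product
`𝒜 ×_{𝓞_{K,v}} Spec L` with `L` a field is irreducible.  The structure map `𝓞_{K,v} → L` factors through `K` (then the fibre product is a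
base change of `𝒜_K ≅ A`) or through `κ(v)` (then it is a base change of the abelian variety `𝒜_v`).
[cite: SerreTate1968GoodReduction, §1] [cite: MumfordFogartyKirwan1994, Ch. 6 §1 Def. 6.1 (p. 115)] -/
theorem geometricallyIrreducible_hom (h : IsAbelianSchemeModel A v 𝒜) : GeometricallyIrreducible 𝒜.hom := by
  refine ⟨(geometrically_iff_of_commRing (P := fun X => IrreducibleSpace X) (f := 𝒜.hom)).2 ?_⟩
  intro L _ _ Y fst snd hpb
  by_cases hφ : Function.Injective (algebraMap (valuationSubringAtPrime K v) L)
  · obtain ⟨ψ, hψ⟩ := exists_comp_eq_of_injective (K := K) (v := v) L hφ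
    exact irreducibleSpace_of_isPullback_of_factor 𝒜.hom (algebraMap (valuationSubringAtPrime K v) K) ψ _ hψ
      h.geometricallyIrreducible_genericFibre_hom fst snd hpb
  · obtain ⟨ψ, hψ⟩ := exists_comp_eq_of_not_injective (K := K) (v := v) L hφ
    exact irreducibleSpace_of_isPullback_of_factor 𝒜.hom (residueAt v) ψ _ hψ
      h.geometricallyIrreducible_specialFibre_hom fst snd hpb

/-- **The structure morphism `𝒜 → Spec 𝓞_{K,v}` of an abelian-scheme model is geometrically connected** («geometric fibres connected»,
[MumfordFogartyKirwan1994] Def. 6.1) — the field `geometricallyConnected` of the tree's bundled `AbelianSchemes.AbelianScheme`, so that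
`{ X := 𝒜, isProper := h.isProper, isSmooth := …, geometricallyConnected := h.geometricallyConnected_hom }` is an
`AbelianScheme (valuationSubringAtPrime K v)` inside any proof. [cite: MumfordFogartyKirwan1994, Ch. 6 §1 Def. 6.1 (p. 115)]
[cite: SerreTate1968GoodReduction, §1] -/
theorem geometricallyConnected_hom (h : IsAbelianSchemeModel A v 𝒜) : GeometricallyConnected 𝒜.hom := by
  haveI := h.geometricallyIrreducible_hom
  exact ⟨fun _ _ y _ fst snd hpb => by
    haveI : IrreducibleSpace _ := GeometricallyIrreducible.geometrically_irreducibleSpace (f := 𝒜.hom) y fst snd hpb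
    infer_instance⟩

end IsAbelianSchemeModel

end Literature.NumberTheory.DiophantineGeometry

end
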